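import Summits.CriticalPhenomena.PercolationContinuityZ3.Theorems.PercNearOneGluingNoHeavyLowerTailSahiOneStepSubblockThreshold
import HarnessLib

/-!
# One-step scheme: the PHANTOM-COORDINATE REDUCTION of the `(2′)` functional to the support block

Support file (prover prim-ineq-prove-3 gen 31; `--supports stmt-CriticalPhenomena-4575`; memo
`run/shared/lean/prim/prim-ineq-prove-3/PROOF-G31-PHANTOM.md` §1).  No definitions, no named facts, no sorries, no `native_decide`.

If the increasing events `A, B` are determined by a sub-block `T ⊆ F` of the threshold block, the coordinates of `R := F ∖ T` are
PHANTOM: they enter `n(Th_t(F); 1_A, 1_B)` only through the Poisson-binomial tail weights `ω_k := μ{N_R + k < t}` (`k = 0..|T|`), and the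
functional becomes the support-block expression
  `n = (Σ_k α_k ω_k)(Σ_k β_k ω_k) + (Σ_k π_k ω_k)·(μ(A∩B) − Σ_k γ_k ω_k) − (Σ_k π_k ω_k)·μ(A)·μ(B)`,
`π_k = μ{N_T = k}`, `α_k = μ(A ∩ {N_T=k})`, `β_k, γ_k` likewise for `B`, `A∩B` (`osN_threshold_eq_phantom`).  This is the identity behind THEOREM PH4
of the memo (machine-certified there): `k ↦ ω_k` is non-increasing with `ω_0 ≤ 1` and log-concave (`ThreshGrid.cdf_logConcave`), so `(2′)` with phantom
coordinates is gen-22's Conjecture G for a log-concave rank weight on `2^T`.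

* `real_inter_ball_eq_sum_phantom` — `μ(E ∩ {N_F < t}) = Σ_k μ(E ∩ {N_T = k})·μ{N_R + k < t}` for `E` determined by `T`;
* `osN_threshold_eq_phantom` — the displayed identity.
-/

noncomputable section

namespace Summit.CriticalPhenomena.PercolationContinuityZ3.Theorems

namespace SahiOneStep

open MeasureTheory Finset
open Literature.Probability.Percolation (DeterminedBy determinedBy_iff)
open Literature.Probability.LatticeModels (prodBernoulli prodBernoulli_real_inter_of_determinedBy_disjoint)
open Literature.Probability.Percolation.DecisionTree (ind)
open scoped Classical

variable {ι : Type*} [Fintype ι] [DecidableEq ι]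

omit [DecidableEq ι] in
/-- **Tail weight of the phantom block as a layer sum**: `μ{N_R + k < t} = Σ_{j ≤ |R|} [j + k < t]·μ{N_R = j}`. [folklore] -/
theorem real_phantomTail_eq_sum (p : ι → unitInterval) (R : Finset ι) (t k : ℕ) :
    (prodBernoulli p).real {ω : Set ι | (R.filter (· ∈ ω)).card + k < t} =
      ∑ j ∈ range (R.card + 1), if j + k < t then (prodBernoulli p).real {ω : Set ι | (R.filter (· ∈ ω)).card = j} else 0 := by
  rw [real_eq_sum_cells p (∅ : Finset ι) R {ω : Set ι | (R.filter (· ∈ ω)).card + k < t}]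
  rw [Finset.card_empty, zero_add, Finset.sum_range_one]
  refine Finset.sum_congr rfl fun j _ => ?_
  have hcell := real_inter_cell_eq_ite p (∅ : Finset ι) R (C := {ω : Set ι | (R.filter (· ∈ ω)).card + k < t})
    (V := Set.univ) (P := j + k < t) (k := 0) (j := j) (fun ω _ hj => by
      simp only [Set.mem_setOf_eq, Set.mem_univ, and_true]; rw [hj])
  rw [hcell]
  split_ifs with hjk
  · congr 1
    ext ω
    simp only [Set.mem_inter_iff, Set.mem_univ, true_and, Set.mem_setOf_eq, Finset.filter_empty, Finset.card_empty, and_true]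
  · rfl

/-- **Phantom decomposition of a ball-restricted measure.**  For `T ⊆ F`, `R = F ∖ T` and an event `E` determined by `T`:
`μ(E ∩ {N_F < t}) = Σ_{k ≤ |T|} μ(E ∩ {N_T = k}) · μ{N_R + k < t}`. [this work] -/
theorem real_inter_ball_eq_sum_phantom (p : ι → unitInterval) (F : Finset ι) {T : Finset ι} (hTF : T ⊆ F) (t : ℕ)
    {E : Set (Set ι)} (hE : DeterminedBy E (↑T : Set ι)) :
    (prodBernoulli p).real (E ∩ {ω : Set ι | ¬ t ≤ (F.filter (· ∈ ω)).card}) =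
      ∑ k ∈ range (T.card + 1), (prodBernoulli p).real (E ∩ {ω : Set ι | (T.filter (· ∈ ω)).card = k}) *
        (prodBernoulli p).real {ω : Set ι | ((F \ T).filter (· ∈ ω)).card + k < t} := by
  classical
  set R : Finset ι := F \ T with hR
  have hTR : Disjoint T R := Finset.disjoint_sdiff
  rw [real_eq_sum_cells p T R (E ∩ {ω : Set ι | ¬ t ≤ (F.filter (· ∈ ω)).card})]
  refine Finset.sum_congr rfl fun k _ => ?_
  -- on the cell `{N_T = k} ∩ {N_R = j}` the ball condition reads `j + k < t`
  have hcell : ∀ j, (prodBernoulli p).real ((E ∩ {ω : Set ι | ¬ t ≤ (F.filter (· ∈ ω)).card}) ∩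
        {ω' : Set ι | (R.filter (· ∈ ω')).card = j} ∩ {ω' : Set ι | (T.filter (· ∈ ω')).card = k}) =
      if j + k < t then (prodBernoulli p).real (E ∩ {ω' : Set ι | (R.filter (· ∈ ω')).card = j} ∩
        {ω' : Set ι | (T.filter (· ∈ ω')).card = k}) else 0 := by
    intro j
    refine real_inter_cell_eq_ite p T R (P := j + k < t) (V := E) (fun ω hk hj => ?_)
    simp only [Set.mem_inter_iff, Set.mem_setOf_eq, card_filter_mem_eq_add F hTF ω, ← hR, hk, hj, not_le]
    constructor
    · rintro ⟨h1, h2⟩; exact ⟨by omega, h1⟩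
    · rintro ⟨h1, h2⟩; exact ⟨h2, by omega⟩
  rw [Finset.sum_congr rfl fun j _ => hcell j, real_phantomTail_eq_sum p R t k, Finset.mul_sum]
  refine Finset.sum_congr rfl fun j _ => ?_
  split_ifs with hjk
  · -- independence of the `T`-determined event `E ∩ {N_T = k}` and the `R`-layer
    have hET : DeterminedBy (E ∩ {ω' : Set ι | (T.filter (· ∈ ω')).card = k}) (↑T : Set ι) :=
      DeterminedBy.inter hE (determinedBy_layer T k)
    have hind := prodBernoulli_real_inter_of_determinedBy_disjoint p hTR hET (determinedBy_layer R j)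
      MeasurableSet.of_discrete MeasurableSet.of_discrete
    rw [← hind]
    congr 1
    ext ω
    simp only [Set.mem_inter_iff, Set.mem_setOf_eq]
    tauto
  · simp

/-- **THE PHANTOM-COORDINATE REDUCTION of `(2′)`.**  For `T ⊆ F`, `R = F ∖ T`, increasing events `A, B` determined by `T`, and the tail weights
`ω_k = μ{N_R + k < t}` of the phantom block:
`n(Th_t(F); 1_A, 1_B) = (Σ_k α_k ω_k)(Σ_k β_k ω_k) + (Σ_k π_k ω_k)(μ(A∩B) − Σ_k γ_k ω_k) − (Σ_k π_k ω_k) μ(A) μ(B)`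
(`π_k = μ{N_T=k}`, `α_k = μ(A ∩ {N_T=k})`, `β_k = μ(B ∩ {N_T=k})`, `γ_k = μ(A ∩ B ∩ {N_T=k})`) — the `(2′)` functional of the phantom problem is
gen-22's rank-reweighted covariance functional on the support block. [this work] -/
theorem osN_threshold_eq_phantom (p : ι → unitInterval) (F : Finset ι) {T : Finset ι} (hTF : T ⊆ F) (t : ℕ)
    {A B : Set (Set ι)} (hA : DeterminedBy A (↑T : Set ι)) (hB : DeterminedBy B (↑T : Set ι)) :
    osN p {ω : Set ι | t ≤ (F.filter (· ∈ ω)).card} (ind A) (ind B) =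
      (∑ k ∈ range (T.card + 1), (prodBernoulli p).real (A ∩ {ω : Set ι | (T.filter (· ∈ ω)).card = k}) *
          (prodBernoulli p).real {ω : Set ι | ((F \ T).filter (· ∈ ω)).card + k < t}) *
        (∑ k ∈ range (T.card + 1), (prodBernoulli p).real (B ∩ {ω : Set ι | (T.filter (· ∈ ω)).card = k}) *
          (prodBernoulli p).real {ω : Set ι | ((F \ T).filter (· ∈ ω)).card + k < t})
      + (∑ k ∈ range (T.card + 1), (prodBernoulli p).real {ω : Set ι | (T.filter (· ∈ ω)).card = k} *
          (prodBernoulli p).real {ω : Set ι | ((F \ T).filter (· ∈ ω)).card + k < t}) *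
        ((prodBernoulli p).real (A ∩ B) -
          ∑ k ∈ range (T.card + 1), (prodBernoulli p).real (A ∩ B ∩ {ω : Set ι | (T.filter (· ∈ ω)).card = k}) *
            (prodBernoulli p).real {ω : Set ι | ((F \ T).filter (· ∈ ω)).card + k < t})
      - (∑ k ∈ range (T.card + 1), (prodBernoulli p).real {ω : Set ι | (T.filter (· ∈ ω)).card = k} *
          (prodBernoulli p).real {ω : Set ι | ((F \ T).filter (· ∈ ω)).card + k < t}) *
        (prodBernoulli p).real A * (prodBernoulli p).real B := by
  -- complements: μ(H ∩ E) = μ(E) − μ(E ∩ L)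
  have hsplit : ∀ E : Set (Set ι), (prodBernoulli p).real ({ω : Set ι | t ≤ (F.filter (· ∈ ω)).card} ∩ E) =
      (prodBernoulli p).real E - (prodBernoulli p).real (E ∩ {ω : Set ι | ¬ t ≤ (F.filter (· ∈ ω)).card}) := by
    intro E
    have hdisj : Disjoint ({ω : Set ι | t ≤ (F.filter (· ∈ ω)).card} ∩ E) (E ∩ {ω : Set ι | ¬ t ≤ (F.filter (· ∈ ω)).card}) := by
      rw [Set.disjoint_left]; rintro ω ⟨hω, _⟩ ⟨_, hω'⟩; exact hω' hω
    have hunion : ({ω : Set ι | t ≤ (F.filter (· ∈ ω)).card} ∩ E) ∪ (E ∩ {ω : Set ι | ¬ t ≤ (F.filter (· ∈ ω)).card}) = E := by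
      ext ω; simp only [Set.mem_union, Set.mem_inter_iff, Set.mem_setOf_eq]; tauto
    have hu := measureReal_union (μ := prodBernoulli p) hdisj (MeasurableSet.of_discrete) (measure_ne_top (prodBernoulli p) _) (measure_ne_top (prodBernoulli p) _)
    rw [hunion] at hu
    linarith
  have huniv : DeterminedBy (Set.univ : Set (Set ι)) (↑T : Set ι) := by
    rw [determinedBy_iff]; intro ω ω' _; simp
  have eA := real_inter_ball_eq_sum_phantom p F hTF t hA
  have eB := real_inter_ball_eq_sum_phantom p F hTF t hB
  have eAB := real_inter_ball_eq_sum_phantom p F hTF t (DeterminedBy.inter hA hB)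
  have eU := real_inter_ball_eq_sum_phantom p F hTF t huniv
  simp only [Set.univ_inter] at eU
  have hHL : (prodBernoulli p).real {ω : Set ι | t ≤ (F.filter (· ∈ ω)).card} =
      1 - (prodBernoulli p).real {ω : Set ι | ¬ t ≤ (F.filter (· ∈ ω)).card} := by
    have h := hsplit Set.univ
    rw [Set.inter_univ, Set.univ_inter, probReal_univ] at h
    exact h
  rw [osN_ind_ind, hsplit A, hsplit B, Set.inter_assoc, hsplit (A ∩ B), hHL, eA, eB, eAB, eU]
  ring

end SahiOneStep

end Summit.CriticalPhenomena.PercolationContinuityZ3.Theorems
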